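import Literature.AlgebraicGeometry.Resolution.RegularCentreBlowupSeqIntegral
import Literature.AlgebraicGeometry.Resolution.RegularCentreBlowupSeqExtension
import Literature.AlgebraicGeometry.Resolution.RegularBlowup
import Literature.AlgebraicGeometry.Resolution.BlowupsIntegral
import Literature.AlgebraicGeometry.Resolution.BlowupsProperProofs
import Literature.AlgebraicGeometry.Resolution.QuasiProjectiveResolution
import Literature.AlgebraicGeometry.Resolution.ProjectiveSpaceRegular
import Literature.AlgebraicGeometry.Resolution.AdicCompletionRegular
import Literature.AlgebraicGeometry.Resolution.ExcellentRingsEssFiniteType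
import Literature.AlgebraicGeometry.Resolution.QuasiExcellentSchemes
import Literature.AlgebraicGeometry.Resolution.ResolutionLU
import Literature.AlgebraicGeometry.Resolution.StrictTransformIsBlowup
import Mathlib.AlgebraicGeometry.Morphisms.FiniteType
import HarnessLib

/-!
# Cofinality of local uniformizations from principalization, I: the principalizing sequence is a resolution

Topic: `Literature/AlgebraicGeometry/Resolution`. PROOF side of `CossartPiltant2019ReductionP`
(`ArithmeticalThreefoldsLocal.lean`): towards the hypothesis (COF) of
`cossartPiltant2019ReductionP_of_parts` (`ArithmeticalThreefoldsLocalSeparableClimb.lean`) —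
cofinality of local uniformizations, [CoP1] Cor. 4.6: "Let `A₀ := k[x₁, …, xₙ]` be an affine
model of `V/k` … Write `xᵢ = fᵢ/gᵢ`, with `fᵢ, gᵢ ∈ R`, `gᵢ ≠ 0`. By proposition 4.2 [=
principalization, Cossart–Piltant 2019 Prop. 4.4, the named fact
`CossartPiltant2019Principalization`], with `X := Spec R` and `I := (fᵢ, gᵢ)`, there exists an
iterated monoidal transform `R′` of `R` along `V` such that `xᵢ ∈ R′`" — from the named fact.
This first file provides the scheme-side inputs:

* `Scheme.isExcellent_Spec_of_isExcellentRing` — PROVED: `Spec R` is an excellent scheme for an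
  excellent ring `R` (its affine opens have coordinate rings of finite type over `R`).
* `IsRegularCentreBlowupSeq.isResolution` — PROVED: a Cossart–Piltant sequence of blowing ups
  along regular centres for `J ≠ 0` over a regular, integral, locally Noetherian scheme is a
  resolution of singularities of its base (proper, birational, regular source): the form in
  which the valuative criterion of properness (`ResolutionLU.lean`) consumes the output of
  `CossartPiltant2019Principalization`.
* `spec_satisfies_principalization_hypotheses` — PROVED: for a regular local excellent domain
  `R` of dimension three, `Spec R` is integral, Noetherian, regular, excellent and
  three-dimensional (Serre's theorem `isRegularRing_of_isRegularLocalRing`, Matsumura 19.3).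

Everything is PROVED; no named facts are introduced.

## Sources

* V. Cossart, O. Piltant, J. Algebra 320 (2008) 1051–1082, Cor. 4.6 (HAL hal-00139124: Cor. 4.6,
  p. 14). [CossartPiltant2008]
* V. Cossart, O. Piltant, J. Algebra 529 (2019), Prop. 4.4 (arXiv v1: Prop. 4.3). [CossartPiltant2019]
-/

noncomputable section

open CategoryTheory CategoryTheory.Limits AlgebraicGeometry TopologicalSpace IsLocalRing

namespace Literature.AlgebraicGeometry.Resolution

universe u

open Scheme.IdealSheafData

/-! ## `Spec` of an excellent ring is an excellent scheme -/

/-- **`Spec R` is excellent for `R` excellent**: the coordinate ring of an affine open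
`U ⊆ Spec R` is of finite type over `R` (the open immersion `U → Spec R` is locally of finite
type between affine schemes), hence excellent (`IsExcellentRing.of_finiteType'`).
[cite: Matsumura1987, §32 p. 260] -/
theorem Scheme.isExcellent_Spec_of_isExcellentRing (R : Type u) [CommRing R]
    (hR : IsExcellentRing R) : Scheme.IsExcellent (Spec (.of R)) := by
  intro U
  have hft : (Scheme.Hom.appLE (𝟙 (Spec (.of R))) ⊤ U le_top).hom.FiniteType :=
    HasRingHomProperty.appLE (P := @LocallyOfFiniteType) (𝟙 (Spec (.of R))) inferInstance
      ⟨⊤, isAffineOpen_top _⟩ U le_top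
  let φ : R →+* Γ(Spec (.of R), U) :=
    (Scheme.Hom.appLE (𝟙 (Spec (.of R))) ⊤ U le_top).hom.comp (Scheme.ΓSpecIso (.of R)).inv.hom
  have hφ : φ.FiniteType :=
    hft.comp (RingHom.FiniteType.of_surjective _
      (Scheme.ΓSpecIso (.of R)).symm.commRingCatIsoToRingEquiv.surjective)
  letI : Algebra R Γ(Spec (.of R), U) := φ.toAlgebra
  haveI : Algebra.FiniteType R Γ(Spec (.of R), U) := hφ
  exact hR.of_finiteType'

/-! ## A Cossart–Piltant sequence for `J ≠ 0` over a regular scheme is a resolution -/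

/-- **A Cossart–Piltant sequence of blowing ups along regular centres is a resolution of
singularities**: for `J ≠ 0` on a regular, integral, locally Noetherian scheme `S`, the
composite `σ : S′ → S` is proper and birational and `S′` is regular (stage by stage: each centre
is a proper closed subset, `nonPrincipalLocus_ne_top`; blowing ups of integral schemes along
non-zero ideals are birational, `IsBlowup.isBirational'`; along regular centres of regular
schemes they are regular, `IsBlowup.isRegular_of_isRegular_subscheme`; and proper,
`IsBlowup.isProper`). [cite: CossartPiltant2019, Prop. 4.4 (arXiv v1: Prop. 4.3)] -/
theorem IsRegularCentreBlowupSeq.isResolution {S' S : Scheme.{u}} {σ : S' ⟶ S}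
    {J : S.IdealSheafData} (h : IsRegularCentreBlowupSeq σ J) [IsIntegral S]
    [IsLocallyNoetherian S] (hJ : J ≠ ⊥) (hS : Scheme.IsRegular S) : IsResolution σ := by
  suffices main : ∀ {S' S : Scheme.{u}} {σ : S' ⟶ S} {J : S.IdealSheafData},
      IsRegularCentreBlowupSeq σ J → IsIntegral S → IsLocallyNoetherian S → J ≠ ⊥ →
      Scheme.IsRegular S → IsResolution σ from main h inferInstance inferInstance hJ hS
  intro S' S σ J h
  induction h with
  | nil J =>
    intro _ _ _ hS
    exact ⟨inferInstance, isBirational_id _, hS⟩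
  | @cons S'' S' S τ σ J Y hσ hYint hYreg hY hτ ih =>
    intro hint hN hJ hS
    have hres : IsResolution σ := ih hint hN hJ hS
    obtain ⟨hint', hN', hJ'⟩ := hσ.isIntegral_and_comap_ne_bot hint hN hJ
    haveI := hint'
    haveI := hN'
    haveI : IsProper τ := hτ.isProper
    haveI : IsProper σ := hres.isProper
    -- the centre is a proper closed subset, so its ideal is non-zero
    have hYtop : (vanishingIdeal Y).support ≠ ⊤ := by
      intro htop
      apply nonPrincipalLocus_ne_top hJ'
      rw [eq_top_iff]
      intro y _
      have hy : y ∈ (Y : Set S') := by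
        rw [← coe_support_vanishingIdeal Y, htop]
        trivial
      exact hY y hy
    have hY0 : vanishingIdeal Y ≠ ⊥ := fun h0 => hYtop (by
      rw [h0, Scheme.IdealSheafData.support_bot])
    exact ⟨inferInstance, (hτ.isBirational' hY0).comp hres.isBirational,
      hτ.isRegular_of_isRegular_subscheme hres.isRegular hYreg⟩

/-! ## `Spec` of a regular local excellent domain of dimension three -/

/-- For a regular local excellent ring `R` of dimension three, `Spec R` satisfies the
hypotheses of `CossartPiltant2019Principalization`: it is integral, Noetherian, regular (Serre:
the localizations of a regular local ring are regular, Matsumura Thm. 19.3), excellent, and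
three-dimensional. [cite: Matsumura1987, Thm. 19.3] -/
theorem spec_satisfies_principalization_hypotheses (R : Type u) [CommRing R]
    [IsRegularLocalRing R] (hR : IsExcellentRing R) (hdim : ringKrullDim R = 3) :
    IsIntegral (Spec (.of R)) ∧ IsNoetherian (Spec (.of R)) ∧ Scheme.IsRegular (Spec (.of R)) ∧
      Scheme.IsExcellent (Spec (.of R)) ∧ topologicalKrullDim (Spec (.of R)) = 3 := by
  haveI : IsDomain R := isDomain_of_isRegularLocalRing R
  haveI : IsDomain (CommRingCat.of R) := ‹IsDomain R›
  haveI : IsNoetherianRing (CommRingCat.of R) := (inferInstance : IsNoetherianRing R)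
  haveI : IsRegularRing (CommRingCat.of R) := isRegularRing_of_isRegularLocalRing R
  refine ⟨inferInstance, inferInstance, Scheme.isRegular_Spec (.of R),
    Scheme.isExcellent_Spec_of_isExcellentRing R hR, ?_⟩
  change topologicalKrullDim (PrimeSpectrum R) = 3
  rw [PrimeSpectrum.topologicalKrullDim_eq_ringKrullDim]
  exact hdim

/-! ## The valuative criterion with a principalized ideal: the fraction lands in the local ring -/

section Principal

variable {A : Type u} [CommRing A] [IsDomain A] {K : Type u} [Field K] [Algebra A K]
  [IsFractionRing A K]

set_option maxHeartbeats 400000 in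
/-- **Local uniformization by a regular model on which `(a, b)` is principal puts `a/b` into the
local ring** (the mechanism of [CoP1] Cor. 4.6: "there exists an iterated monoidal transform
`R′` of `R` along `V` such that `xᵢ ∈ R′`"). Let `π : X → Spec A` be proper and birational with
`X` regular (e.g. the output of principalization along regular centres,
`IsRegularCentreBlowupSeq.isResolution`), `O ⊇ A` a valuation ring of `K = Frac A`, and
`a, b ∈ A`, `b ≠ 0`, with `a/b ∈ O`, such that the ideal sheaf `(a, b)𝒪_X` is locally principal.
Then there is a finitely generated `A`-subalgebra `T ⊆ O` of `K` whose localisation at the centre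
`𝔪_O ∩ T` is regular AND contains `a/b`: `a/b = y/s` with `y, s ∈ T`, `s` a unit of `O`. Proof:
as in `exists_fg_regular_of_hasResolution` (valuative criterion, centre `x′`, `𝒪_{X,x′} ↪ O`,
`T :=` the image of an affine neighbourhood, `T_{𝔪_O ∩ T} ≅ 𝒪_{X,x′}`), the neighbourhood being
one on which `(a, b) = (f)`; in the regular (hence integral) local ring `𝒪_{X,x′}` write
`a = a₁ f`, `b = b₁ f`, `f = u a + w b`: then `a₁` or `b₁` is a unit, and `a₁ ∈ 𝒪^×`,
`b₁ ∈ 𝔪` is excluded by `v(a/b) ≤ 1`; so `a/b = a₁/b₁ ∈ 𝒪_{X,x′}`.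
[cite: CossartPiltant2008, Cor. 4.6 (HAL p. 14)] -/
theorem exists_fg_regular_mem_of_isResolution (O : ValuationSubring K)
    (hAO : ∀ a : A, algebraMap A K a ∈ O) {X : Scheme.{u}} {π : X ⟶ Spec (.of A)}
    (hπ : IsResolution π) (a b : A) (hb : b ≠ 0)
    (hx : algebraMap A K a / algebraMap A K b ∈ O)
    (hprinc : IsLocallyPrincipal ((ofIdealTop (Ideal.span
      {(Scheme.ΓSpecIso (.of A)).inv a, (Scheme.ΓSpecIso (.of A)).inv b})).comap π)) :
    ∃ (T : Subalgebra A K) (h : T.toSubring ≤ O.toSubring), T.FG ∧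
      IsRegularLocalRing (Localization.AtPrime
        (Ideal.comap (Subring.inclusion h) (IsLocalRing.maximalIdeal O))) ∧
      ∃ y s : K, y ∈ T ∧ s ∈ T ∧ O.valuation s = 1 ∧
        algebraMap A K a / algebraMap A K b * s = y := by
  classical
  haveI := hπ.isProper
  obtain ⟨U, hUd, -, hUiso⟩ := hπ.isBirational
  haveI : IsDomain (CommRingCat.of A) := ‹IsDomain A›
  -- the ring maps `A → O → K`
  let φ₀ : A →+* O := (algebraMap A K).codRestrict O.toSubring hAO
  let ιOK : CommRingCat.of O ⟶ CommRingCat.of K := CommRingCat.ofHom (algebraMap O K)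
  let i₂ : Spec (.of O) ⟶ Spec (.of A) := Spec.map (CommRingCat.ofHom φ₀)
  let g : Spec (.of K) ⟶ Spec (.of A) := Spec.map (CommRingCat.ofHom (algebraMap A K))
  have hg : Spec.map ιOK ≫ i₂ = g := by
    rw [← Spec.map_comp]
    rfl
  -- the generic point of `Spec A` lies in `U`
  let q : Spec (.of K) := closedPoint K
  have hgq : g q = (⊥ : PrimeSpectrum A) := by
    change PrimeSpectrum.comap (algebraMap A K) (closedPoint K) = ⊥
    ext1
    rw [PrimeSpectrum.comap_asIdeal]
    change Ideal.comap (algebraMap A K) (maximalIdeal K) = ⊥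
    rw [maximalIdeal_eq_bot, ← RingHom.ker_eq_comap_bot, RingHom.ker_eq_bot_iff_eq_zero]
    intro a ha
    exact (IsFractionRing.injective A K) (by rw [ha, map_zero])
  have hbotU : ((⊥ : PrimeSpectrum A) : Spec (.of A)) ∈ U := by
    haveI : Nonempty (Spec (.of A)) := ⟨(⊥ : PrimeSpectrum A)⟩
    obtain ⟨y, hy⟩ := hUd.nonempty
    exact ((PrimeSpectrum.le_iff_specializes _ y).mp bot_le).mem_open U.isOpen hy
  have hrange : Set.range g.base ⊆ Set.range U.ι.base := by
    rw [Scheme.Opens.range_ι]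
    rintro _ ⟨p, rfl⟩
    obtain rfl : p = q := Subsingleton.elim _ _
    rw [hgq]; exact hbotU
  let g₁ : Spec (.of K) ⟶ U := IsOpenImmersion.lift U.ι g hrange
  have hg₁ : g₁ ≫ U.ι = g := IsOpenImmersion.lift_fac _ _ _
  haveI := hUiso
  let j : ↑(π ⁻¹ᵁ U) ⟶ X := (π ⁻¹ᵁ U).ι
  let i₁ : Spec (.of K) ⟶ X := g₁ ≫ inv (π ∣_ U) ≫ j
  have hsq : i₁ ≫ π = Spec.map ιOK ≫ i₂ := by
    rw [hg]
    simp only [i₁, j, Category.assoc, ← morphismRestrict_ι, IsIso.inv_hom_id_assoc, hg₁]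
  -- valuative criterion of properness
  have hex : ValuativeCriterion.Existence π := by
    have h := (inferInstance : UniversallyClosed π)
    rw [UniversallyClosed.eq_valuativeCriterion] at h
    exact h.1
  obtain ⟨l, hl₁, hl₂⟩ :=
    (hex { R := O, K := K, i₁ := i₁, i₂ := i₂, commSq := ⟨hsq⟩ }).exists_lift
  -- the centre `x' = l(𝔪_O)` and its regular (hence integral) local ring
  set c : Spec (.of O) := closedPoint O with hc
  haveI hregx : IsRegularLocalRing (X.presheaf.stalk (l c)) := hπ.isRegular (l c)
  haveI : IsDomain (X.presheaf.stalk (l c)) := Matsumura1987_14_3_holds _ hregx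
  let ψ := Scheme.stalkClosedPointTo l
  -- `ψ : 𝒪_{X,x'} → O` is injective
  have hψ : Function.Injective ψ := by
    let γ₀ : Spec (.of O) := Spec.map ιOK q
    have hγc : γ₀ ⤳ c := IsLocalRing.specializes_closedPoint γ₀
    have hE1 : Function.Injective (l.stalkMap γ₀) := by
      have h1 : Function.Injective (g.stalkMap q) := by
        have hF : IsField ((Spec (.of A)).presheaf.stalk (g q)) := by
          refine isField_stalk_of_eq ?_ (Field.toIsField (Spec (.of A)).functionField)
          rw [genericPoint_eq_bot_of_affine, hgq]
        letI := hF.toField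
        exact RingHom.injective _
      have h2 : Function.Injective (g₁.stalkMap q) := by
        rw [← stalkMap_injective_congr hg₁, Scheme.Hom.stalkMap_comp] at h1
        exact Function.Injective.of_comp_right h1
          (ConcreteCategory.bijective_of_isIso (U.ι.stalkMap (g₁ q))).2
      have h3 : Function.Injective (i₁.stalkMap q) := by
        change Function.Injective ((g₁ ≫ inv (π ∣_ U) ≫ j).stalkMap q)
        rw [Scheme.Hom.stalkMap_comp]
        exact h2.comp (ConcreteCategory.bijective_of_isIso ((inv (π ∣_ U) ≫ j).stalkMap _)).1
      rw [← stalkMap_injective_congr hl₁, Scheme.Hom.stalkMap_comp] at h3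
      have h4 : Function.Injective ((Spec.map ιOK).stalkMap q ∘ l.stalkMap γ₀) := h3
      exact Function.Injective.of_comp h4
    have hE2 := stalkSpecializes_injective_of_isDomain (l.base.hom.map_specializes hγc)
    have hE := Scheme.Hom.stalkSpecializes_stalkMap l γ₀ c hγc
    have hcomp : Function.Injective
        (l.stalkMap c ≫ (Spec (.of O)).presheaf.stalkSpecializes hγc) := by
      rw [← hE, CategoryTheory.hom_comp]
      exact hE1.comp hE2
    rw [CategoryTheory.hom_comp] at hcomp
    have hl : Function.Injective (l.stalkMap c) := Function.Injective.of_comp hcomp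
    change Function.Injective (l.stalkMap c ≫ (stalkClosedPointIso (.of O)).hom)
    rw [CategoryTheory.hom_comp]
    exact (ConcreteCategory.bijective_of_isIso (stalkClosedPointIso (.of O)).hom).1.comp hl
  -- an affine neighbourhood `V ∋ x'` on which `(a, b)𝒪_X = (f)`, of finite type over `A`
  obtain ⟨⟨V, hV⟩, hxV, f, hf⟩ := hprinc (l c)
  have hft : (π.appLE ⊤ V le_top).hom.FiniteType :=
    HasRingHomProperty.appLE (P := @LocallyOfFiniteType) π inferInstance ⟨⊤, isAffineOpen_top _⟩
      ⟨V, hV⟩ le_top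
  let α : A →+* Γ(X, V) := (π.appLE ⊤ V le_top).hom.comp (Scheme.ΓSpecIso (.of A)).inv.hom
  have hα : α.FiniteType :=
    hft.comp (RingHom.FiniteType.of_surjective _
      (Scheme.ΓSpecIso (.of A)).symm.commRingCatIsoToRingEquiv.surjective)
  let β : Γ(X, V) →+* O := ψ.hom.comp (X.presheaf.germ V (l c) hxV).hom
  -- compatibility `β ∘ α = (A → O)`
  have key1 : π.appLE ⊤ V le_top ≫ X.presheaf.germ V (l c) hxV =
      (Spec (.of A)).presheaf.germ ⊤ (π (l c)) trivial ≫ π.stalkMap (l c) := by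
    rw [Scheme.Hom.germ_stalkMap, Scheme.Hom.appLE, Category.assoc, TopCat.Presheaf.germ_res]
  have key2 : (Spec (.of A)).presheaf.germ ⊤ ((l ≫ π) c) trivial ≫
      Scheme.stalkClosedPointTo (l ≫ π) = (Scheme.ΓSpecIso (.of A)).hom ≫ CommRingCat.ofHom φ₀ := by
    rw [germ_stalkClosedPointTo_congr hl₂ ⊤ trivial]
    exact Scheme.germ_stalkClosedPointTo_Spec (CommRingCat.ofHom φ₀)
  have key3 : (Spec (.of A)).presheaf.germ ⊤ (π (l c)) trivial ≫ π.stalkMap (l c) ≫ ψ =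
      (Scheme.ΓSpecIso (.of A)).hom ≫ CommRingCat.ofHom φ₀ := by
    rw [← key2, Scheme.stalkClosedPointTo_comp]
    rfl
  have key : (Scheme.ΓSpecIso (.of A)).inv ≫ π.appLE ⊤ V le_top ≫
      X.presheaf.germ V (l c) hxV ≫ ψ = CommRingCat.ofHom φ₀ := by
    rw [← Category.assoc (π.appLE ⊤ V le_top), key1, Category.assoc, key3, Iso.inv_hom_id_assoc]
  have hβα : ∀ a, β (α a) = φ₀ a := fun a => by
    have := ConcreteCategory.congr_hom key a
    simp only [CategoryTheory.comp_apply, CommRingCat.hom_ofHom] at this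
    exact this
  -- the prime of `Γ(X, V)` at `x'` is the preimage of `𝔪_O`
  letI algx := X.presheaf.algebra_section_stalk (⟨l c, hxV⟩ : V)
  have hlocx := hV.isLocalization_stalk ⟨l c, hxV⟩
  set 𝔮 := (hV.primeIdealOf ⟨l c, hxV⟩).asIdeal with h𝔮def
  have h𝔮 : 𝔮 = Ideal.comap β (maximalIdeal O) := by
    rw [h𝔮def, IsAffineOpen.primeIdealOf_eq_map_closedPoint, Spec.map_apply,
      PrimeSpectrum.comap_asIdeal]
    change Ideal.comap (X.presheaf.germ V (l c) hxV).hom (maximalIdeal _) =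
      Ideal.comap (ψ.hom.comp (X.presheaf.germ V (l c) hxV).hom) (maximalIdeal O)
    rw [← Ideal.comap_comap, IsLocalRing.maximalIdeal_comap ψ.hom]
  -- the uniformizing algebra `T = image of Γ(X, V)` in `K`
  letI : Algebra A Γ(X, V) := α.toAlgebra
  haveI : Algebra.FiniteType A Γ(X, V) := hα
  let γ : Γ(X, V) →ₐ[A] K :=
    { (algebraMap O K).comp β with
      commutes' := fun a => by
        change algebraMap O K (β (α a)) = algebraMap A K a
        rw [hβα]; rfl }
  let T : Subalgebra A K := γ.range
  have hTfg : T.FG := by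
    change (γ.range).FG
    rw [← Algebra.map_top]; exact Subalgebra.FG.map _ Algebra.FiniteType.out
  have hTO : T.toSubring ≤ O.toSubring := by
    rintro _ ⟨b, rfl⟩; exact (β b).2
  set P := Ideal.comap (Subring.inclusion hTO) (maximalIdeal O) with hP
  let γ' : Γ(X, V) →+* T := γ.rangeRestrict.toRingHom
  have hγ' : ∀ b, ((γ' b : T) : K) = (β b : K) := fun b => rfl
  have hγ'sur : Function.Surjective γ' := AlgHom.rangeRestrict_surjective γ
  have hPq : Ideal.comap γ' P = 𝔮 := by
    ext b
    rw [h𝔮]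
    change Subring.inclusion hTO (γ' b) ∈ maximalIdeal O ↔ β b ∈ maximalIdeal O
    rw [show Subring.inclusion hTO (γ' b) = β b from Subtype.ext rfl]
  have hMle : 𝔮.primeCompl ≤ P.primeCompl.comap γ' := fun b hb hb' => hb (by
    rw [← hPq]; exact hb')
  let δ : X.presheaf.stalk (l c) →+* Localization.AtPrime P :=
    IsLocalization.map (Localization.AtPrime P) γ' hMle
  have hδsurj : Function.Surjective δ := by
    intro z
    obtain ⟨t, u, rfl⟩ := IsLocalization.exists_mk'_eq P.primeCompl z
    obtain ⟨b, rfl⟩ := hγ'sur t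
    obtain ⟨s, hs⟩ := hγ'sur u
    have hsq : s ∉ 𝔮 := by
      intro hs𝔮
      rw [← hPq, Ideal.mem_comap, hs] at hs𝔮
      exact u.2 hs𝔮
    refine ⟨IsLocalization.mk' _ b (⟨s, hsq⟩ : 𝔮.primeCompl), ?_⟩
    rw [IsLocalization.map_mk']
    congr 1
    exact Subtype.ext hs
  have hδinj : Function.Injective δ := by
    rw [injective_iff_map_eq_zero]
    intro z hz
    obtain ⟨b, s, rfl⟩ := IsLocalization.exists_mk'_eq 𝔮.primeCompl z
    rw [IsLocalization.map_mk', IsLocalization.mk'_eq_zero_iff] at hz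
    obtain ⟨⟨m, hm⟩, hmb⟩ := hz
    have hm0 : m ≠ 0 := fun h => hm (by rw [h]; exact P.zero_mem)
    have hb0 : γ' b = 0 := (mul_eq_zero.mp hmb).resolve_left hm0
    have hβb : β b = 0 := by
      have h1 : ((γ' b : T) : K) = 0 := by rw [hb0]; rfl
      rw [hγ'] at h1
      exact_mod_cast h1
    have hgerm : X.presheaf.germ V (l c) hxV b = 0 :=
      hψ (by rw [map_zero]; exact hβb)
    rw [IsLocalization.mk'_eq_mul_mk'_one]
    change X.presheaf.germ V (l c) hxV b * _ = 0
    rw [hgerm, zero_mul]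
  have hreg : IsRegularLocalRing (Localization.AtPrime P) :=
    IsRegularLocalRing.of_ringEquiv (RingEquiv.ofBijective δ ⟨hδinj, hδsurj⟩)
  refine ⟨T, hTO, hTfg, hreg, ?_⟩
  /- the ideal `(a, b)` becomes `(f)` on `V`: chart formula for the pull-back ideal sheaf -/
  have hVle : (V : X.Opens) ≤ π ⁻¹ᵁ ((⟨⊤, isAffineOpen_top _⟩ : (Spec (.of A)).affineOpens) :
      (Spec (.of A)).Opens) := fun _ _ => trivial
  have hideal : Ideal.span {α a, α b} = Ideal.span {f} := by
    rw [← hf, ideal_comap_eq_map_of_le π _ ⟨⊤, isAffineOpen_top _⟩ ⟨V, hV⟩ hVle,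
      Scheme.IdealSheafData.ofIdealTop_ideal, Ideal.map_map, Ideal.map_span]
    congr 1
    have hr : (Spec (.of A)).presheaf.map (homOfLE (le_top :
        ((⟨⊤, isAffineOpen_top _⟩ : (Spec (.of A)).affineOpens) : (Spec (.of A)).Opens) ≤ ⊤)).op =
        𝟙 _ := by
      rw [show (homOfLE (le_top : ((⟨⊤, isAffineOpen_top _⟩ : (Spec (.of A)).affineOpens) :
        (Spec (.of A)).Opens) ≤ ⊤)).op = 𝟙 _ from Subsingleton.elim _ _]
      exact (Spec (.of A)).presheaf.map_id _
    ext z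
    simp only [Set.image_insert_eq, Set.image_singleton, Set.mem_insert_iff,
      Set.mem_singleton_iff, RingHom.coe_comp, Function.comp_apply, hr]
    rfl
  /- in the stalk `B = 𝒪_{X,x'}`: `a = a₁ f`, `b = b₁ f`, `f = u a + w b` -/
  let g₀ : Γ(X, V) →+* X.presheaf.stalk (l c) := (X.presheaf.germ V (l c) hxV).hom
  have hψg₀ : ∀ z, ψ (g₀ z) = β z := fun z => rfl
  have haf : α a ∈ Ideal.span {f} := hideal ▸ Ideal.subset_span (by simp)
  have hbf : α b ∈ Ideal.span {f} := hideal ▸ Ideal.subset_span (by simp)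
  have hfab : f ∈ Ideal.span {α a, α b} := hideal.symm ▸ Ideal.subset_span (by simp)
  obtain ⟨a₁, ha₁⟩ := Ideal.mem_span_singleton'.mp haf
  obtain ⟨b₁, hb₁⟩ := Ideal.mem_span_singleton'.mp hbf
  obtain ⟨u, w, huw⟩ := Ideal.mem_span_pair.mp hfab
  have hbK : algebraMap A K b ≠ 0 := fun h0 =>
    hb ((IsFractionRing.injective A K) (by rw [h0, map_zero]))
  have hβb : ((β (α b) : O) : K) = algebraMap A K b := by rw [hβα]; rfl
  have hβa : ((β (α a) : O) : K) = algebraMap A K a := by rw [hβα]; rfl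
  have hb'' : g₀ (α b) ≠ 0 := by
    intro h0
    apply hbK
    rw [← hβb, ← hψg₀, h0, map_zero]
    rfl
  have hf'' : g₀ f ≠ 0 := by
    intro h0
    apply hb''
    rw [← hb₁, map_mul, h0, mul_zero]
  have hone : g₀ u * g₀ a₁ + g₀ w * g₀ b₁ = 1 := by
    have h1 := congrArg g₀ huw
    rw [← ha₁, ← hb₁, map_add, map_mul, map_mul, map_mul, map_mul] at h1
    have h2 : g₀ f * (g₀ u * g₀ a₁ + g₀ w * g₀ b₁) = g₀ f * 1 := by
      rw [mul_one]
      linear_combination h1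
    exact mul_left_cancel₀ hf'' h2
  have hunit : IsUnit (g₀ a₁) ∨ IsUnit (g₀ b₁) := by
    have h1 : IsUnit (g₀ u * g₀ a₁ + g₀ w * g₀ b₁) := by rw [hone]; exact isUnit_one
    rcases IsLocalRing.isUnit_or_isUnit_of_isUnit_add h1 with h | h
    · exact Or.inl (isUnit_of_mul_isUnit_right h)
    · exact Or.inr (isUnit_of_mul_isUnit_right h)
  -- an element `βel` of the stalk with `βel · b = a`
  have hexβ : ∃ βel : X.presheaf.stalk (l c), βel * g₀ (α b) = g₀ (α a) := by
    by_cases hb₁u : IsUnit (g₀ b₁)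
    · obtain ⟨bu, hbu⟩ := hb₁u
      refine ⟨g₀ a₁ * ↑bu⁻¹, ?_⟩
      rw [← hb₁, ← ha₁, map_mul, map_mul, ← hbu, mul_assoc,
        ← mul_assoc (↑bu⁻¹ : X.presheaf.stalk (l c)), Units.inv_mul, one_mul]
    · -- `a₁` is a unit and `b₁ ∈ 𝔪`: then `v(a/b) = 1/v(b₁) > 1`, contradicting `a/b ∈ O`
      exfalso
      have ha₁u : IsUnit (g₀ a₁) := hunit.resolve_right hb₁u
      have hb₁m : ψ (g₀ b₁) ∈ maximalIdeal O := by
        refine (IsLocalRing.mem_maximalIdeal _).mpr fun hu => hb₁u ?_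
        exact (isUnit_map_iff ψ.hom (g₀ b₁)).mp hu
      have hva₁ : O.valuation ((ψ (g₀ a₁) : O) : K) = 1 :=
        (O.valuation_eq_one_iff _).mp (ha₁u.map ψ.hom)
      have hvb₁ : O.valuation ((ψ (g₀ b₁) : O) : K) < 1 :=
        (ValuationSubring.valuation_lt_one_iff O _).mp hb₁m
      have hB₁0 : ((ψ (g₀ b₁) : O) : K) ≠ 0 := by
        intro h0
        have h1 : ψ (g₀ b₁) = 0 := Subtype.ext h0
        have h2 : g₀ b₁ = 0 := hψ (by rw [h1, map_zero])
        apply hb''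
        rw [← hb₁, map_mul, h2, zero_mul]
      -- `a = a₁ f`, `b = b₁ f` read in `K`
      have haK : algebraMap A K a = ((ψ (g₀ a₁) : O) : K) * ((ψ (g₀ f) : O) : K) := by
        rw [← hβa, ← hψg₀, ← ha₁, map_mul, map_mul]
        rfl
      have hbK' : algebraMap A K b = ((ψ (g₀ b₁) : O) : K) * ((ψ (g₀ f) : O) : K) := by
        rw [← hβb, ← hψg₀, ← hb₁, map_mul, map_mul]
        rfl
      have hF0 : ((ψ (g₀ f) : O) : K) ≠ 0 := by
        intro h0
        apply hbK
        rw [hbK', h0, mul_zero]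
      have hxeq : algebraMap A K a / algebraMap A K b * ((ψ (g₀ b₁) : O) : K) =
          ((ψ (g₀ a₁) : O) : K) := by
        rw [haK, hbK']
        field_simp
      have hvx : O.valuation (algebraMap A K a / algebraMap A K b) ≤ 1 :=
        (O.valuation_le_one_iff _).mpr hx
      have hlt : O.valuation (algebraMap A K a / algebraMap A K b * ((ψ (g₀ b₁) : O) : K)) < 1 := by
        rw [map_mul]
        calc O.valuation (algebraMap A K a / algebraMap A K b) * O.valuation ((ψ (g₀ b₁) : O) : K)
            ≤ 1 * O.valuation ((ψ (g₀ b₁) : O) : K) := by gcongr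
          _ = O.valuation ((ψ (g₀ b₁) : O) : K) := one_mul _
          _ < 1 := hvb₁
      rw [hxeq, hva₁] at hlt
      exact lt_irrefl _ hlt
  obtain ⟨βel, hβel⟩ := hexβ
  -- transport through `δ : 𝒪_{X,x'} ≅ T_P`
  have hδg : ∀ z, δ (g₀ z) = algebraMap T (Localization.AtPrime P) (γ' z) := fun z =>
    IsLocalization.map_eq hMle z
  obtain ⟨y₀, s₀, hys⟩ := IsLocalization.exists_mk'_eq P.primeCompl (δ βel)
  have hrel : IsLocalization.mk' (Localization.AtPrime P) y₀ s₀ *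
      algebraMap T (Localization.AtPrime P) (γ' (α b)) =
      algebraMap T (Localization.AtPrime P) (γ' (α a)) := by
    rw [hys, ← hδg, ← hδg, ← map_mul, hβel]
  have hrel2 : algebraMap T (Localization.AtPrime P) (y₀ * γ' (α b)) =
      algebraMap T (Localization.AtPrime P) (γ' (α a) * (s₀ : T)) := by
    rw [map_mul, map_mul, ← hrel]
    have hsp : IsLocalization.mk' (Localization.AtPrime P) y₀ s₀ *
        algebraMap T (Localization.AtPrime P) (s₀ : T) =
        algebraMap T (Localization.AtPrime P) y₀ := IsLocalization.mk'_spec _ y₀ s₀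
    calc algebraMap T (Localization.AtPrime P) y₀ * algebraMap T (Localization.AtPrime P) (γ' (α b))
        = IsLocalization.mk' (Localization.AtPrime P) y₀ s₀ *
            algebraMap T (Localization.AtPrime P) (s₀ : T) *
            algebraMap T (Localization.AtPrime P) (γ' (α b)) := by rw [hsp]
      _ = IsLocalization.mk' (Localization.AtPrime P) y₀ s₀ *
            algebraMap T (Localization.AtPrime P) (γ' (α b)) *
            algebraMap T (Localization.AtPrime P) (s₀ : T) := by ring
  obtain ⟨⟨uu, huu⟩, hu⟩ := (IsLocalization.eq_iff_exists P.primeCompl _).mp hrel2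
  have huu0 : ((uu : T) : K) ≠ 0 := fun h0 => huu (by
    have : uu = 0 := Subtype.ext h0
    rw [this]
    exact P.zero_mem)
  have hK : ((y₀ : T) : K) * algebraMap A K b = algebraMap A K a * ((s₀ : T) : K) := by
    have h1 := congrArg (fun z : T => (z : K)) hu
    simp only at h1
    push_cast at h1
    rw [hγ', hγ', hβb, hβa] at h1
    exact mul_left_cancel₀ huu0 h1
  refine ⟨((y₀ : T) : K), ((s₀ : T) : K), y₀.2, (s₀ : T).2, ?_, ?_⟩
  · -- `s₀ ∉ P`, i.e. `s₀` is a unit of `O`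
    let x₀ : O := ⟨((s₀ : T) : K), hTO (s₀ : T).2⟩
    have hs₀ : x₀ ∉ maximalIdeal O := s₀.2
    have hu' : IsUnit x₀ :=
      not_not.mp fun hnu => hs₀ ((IsLocalRing.mem_maximalIdeal x₀).mpr hnu)
    exact (O.valuation_eq_one_iff x₀).mp hu'
  · rw [div_mul_eq_mul_div, div_eq_iff hbK, hK]

end Principal

end Literature.AlgebraicGeometry.Resolution

end
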